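import Literature.Analysis.PDE.FreeFlowSobolev
import HarnessLib

/-!
# The zero-initial-value solution of the inhomogeneous heat equation and its Sobolev-energy
# estimates of every order (topic `Analysis/PDE`)

Analytic layer of the programme to prove short-time existence for quasilinear strictly
parabolic systems on a closed manifold (hypothesis `hQL` of
`Literature.Geometry.Riemannian.ricciFlow_shortTime_existence_of_quasilinear`). For a space–time
test field `Θ` on `ℝ × E` (in the application: a smooth extension to `t < 0` of data given on
`[0, T]`) the forward Duhamel integral `V = 𝒱[Θ]` solves `∂ₜV = νΔV + Θ` on all of `ℝ` but has
the value `h = V(0)` at the initial time. Subtracting the free flow of `h` gives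

* `heatDuhamelZero ν Θ t = 𝒱[Θ](t) - e^{νtΔ}(𝒱[Θ](0))` (`freeFlow`, `HeatFreeFlowAdmissible.lean`),

the solution of `∂ₜv = νΔv + Θ` on `[0, ∞)` with `v(0) = 0` (Evans, *PDE*, §2.3.1, Thm. 2 and
the remark after it: general initial data by superposition with the homogeneous solution):

* `heatDuhamelZero_zero` (`v(0) = 0`), `fderiv_heatDuhamelZero_apply` /
  `laplacian_heatDuhamelZero` (derivatives fall on the data), `hasDerivWithinAt_heatDuhamelZero`
  (the heat equation on `[0, ∞)`, one-sided at `t = 0`), smoothness of the slices;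
* **the estimates of every Sobolev order on `[0, T]`** for data with time support in `[τ₀, b]`,
  `τ₀ ≤ 0 ≤ T`, `Q_k = ∫_{τ₀}^T E_k(Θ)`:
  `E_k(v(t)) ≤ 16(T-τ₀) Q_k` (`sobolevEnergy_heatDuhamelZero_le`),
  `∫_0^T Σᵢ E_k(∂ᵢv) ≤ (4(T-τ₀)/ν + 4nT/ν) Q_k`
  (`lintegral_sum_sobolevEnergy_fderiv_heatDuhamelZero_le`), and the `T`-INDEPENDENT maximal
  regularity `∫_0^T Σᵢⱼ E_k(∂ⱼ∂ᵢv) ≤ (6n/ν²) Q_k`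
  (`lintegral_sum_sobolevEnergy_fderiv_fderiv_heatDuhamelZero_le`) — the free part is controlled
  by the gradient of `𝒱[Θ]` at time `0` (`sum_sobolevEnergy_fderiv_heatDuhamelFwd_le`) and the
  energy inequality of the free flow (`lintegral_sum_sobolevEnergy_fderiv_freeFlow_le`).

Everything is proved; no named fact and no `sorry` is introduced.

## References

* L. C. Evans, *Partial Differential Equations*, 2nd ed., AMS 2010, §2.3.1, Thm. 2 and the
  following remark ((17): solution of the general initial-value problem). [Evans2010]
* P. G. Lemarié-Rieusset, *The Navier–Stokes problem in the 21st century*, CRC Press 2016,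
  Prop. 4.3, p. 74. [LemarieRieusset2016]
-/

noncomputable section

open MeasureTheory Set Function Filter Topology TopologicalSpace Metric InnerProductSpace
open scoped RealInnerProductSpace Laplacian ContDiff

namespace Literature.Analysis.PDE

open Literature.Analysis.UnboundedOperators Literature.Analysis.FluidPDE
  Literature.Analysis.FunctionSpaces

variable {E : Type*} [NormedAddCommGroup E] [InnerProductSpace ℝ E] [FiniteDimensional ℝ E]
  [MeasurableSpace E] [BorelSpace E]
variable {F' : Type*} [NormedAddCommGroup F'] [InnerProductSpace ℝ F'] [FiniteDimensional ℝ F']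

/-- **The zero-initial-value Duhamel solution** `v(t) = 𝒱[Θ](t) - e^{νtΔ}(𝒱[Θ](0))` of
`∂ₜv = νΔv + Θ` on `[0, ∞)`, `v(0) = 0` (Evans, §2.3.1, Thm. 2 and (17)).
[cite: Evans2010, §2.3.1, Thm. 2] -/
def heatDuhamelZero (ν : ℝ) (Θ : ℝ → E → F') (t : ℝ) (x : E) : F' :=
  heatDuhamelFwd ν Θ t x - freeFlow ν (heatDuhamelFwd ν Θ 0) t x

variable {ν : ℝ} {Θ : ℝ → E → F'}

omit [FiniteDimensional ℝ F'] in
/-- Unfolding. [folklore] -/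
theorem heatDuhamelZero_apply (ν : ℝ) (Θ : ℝ → E → F') (t : ℝ) (x : E) :
    heatDuhamelZero ν Θ t x = heatDuhamelFwd ν Θ t x - freeFlow ν (heatDuhamelFwd ν Θ 0) t x := rfl

omit [FiniteDimensional ℝ F'] in
/-- **Zero initial value**: `v(0) = 0`. [cite: Evans2010, §2.3.1, Thm. 2] -/
@[simp]
theorem heatDuhamelZero_zero (ν : ℝ) (Θ : ℝ → E → F') :
    heatDuhamelZero ν Θ 0 = 0 := by
  funext x
  simp [heatDuhamelZero]

/-- The slices of `v` are smooth. [folklore] -/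
theorem contDiff_heatDuhamelZero (hΘ : IsSpaceTimeTestOn (⊤ : Opens (ℝ × E)) Θ) (hν : 0 < ν)
    (t : ℝ) : ContDiff ℝ ∞ (heatDuhamelZero ν Θ t) := by
  haveI : CompleteSpace F' := FiniteDimensional.complete ℝ F'
  exact (contDiff_heatDuhamelFwd hΘ hν t).sub
    ((isHeatAdmissible_heatDuhamelFwd hν hΘ 0).freeFlow hν t).contDiff

/-- **Directional derivatives fall on the data**: `∂ᵥ v[Θ](t) = v[∂ᵥΘ](t)`. [folklore] -/
theorem fderiv_heatDuhamelZero_apply (hΘ : IsSpaceTimeTestOn (⊤ : Opens (ℝ × E)) Θ) (hν : 0 < ν)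
    (t : ℝ) (x v : E) :
    fderiv ℝ (heatDuhamelZero ν Θ t) x v =
      heatDuhamelZero ν (fun s y ↦ fderiv ℝ (Θ s) y v) t x := by
  haveI : CompleteSpace F' := FiniteDimensional.complete ℝ F'
  have hh := isHeatAdmissible_heatDuhamelFwd hν hΘ 0
  have hd1 : DifferentiableAt ℝ (heatDuhamelFwd ν Θ t) x :=
    ((contDiff_heatDuhamelFwd hΘ hν t).differentiable (by simp)) x
  have hd2 : DifferentiableAt ℝ (freeFlow ν (heatDuhamelFwd ν Θ 0) t) x :=
    ((hh.freeFlow hν t).contDiff.differentiable (by simp)) x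
  rw [show heatDuhamelZero ν Θ t = fun y ↦ heatDuhamelFwd ν Θ t y -
      freeFlow ν (heatDuhamelFwd ν Θ 0) t y from rfl, fderiv_fun_sub hd1 hd2]
  show fderiv ℝ (heatDuhamelFwd ν Θ t) x v - fderiv ℝ (freeFlow ν (heatDuhamelFwd ν Θ 0) t) x v = _
  rw [fderiv_heatDuhamelFwd_apply hΘ hν t x v, fderiv_freeFlow_apply hh hν t x v,
    heatDuhamelZero_apply]
  congr 2
  exact fderiv_heatDuhamelFwd_eq hΘ hν 0 v

/-- Function form of `fderiv_heatDuhamelZero_apply`. [folklore] -/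
theorem fderiv_heatDuhamelZero_eq (hΘ : IsSpaceTimeTestOn (⊤ : Opens (ℝ × E)) Θ) (hν : 0 < ν)
    (t : ℝ) (v : E) :
    (fun x ↦ fderiv ℝ (heatDuhamelZero ν Θ t) x v) =
      heatDuhamelZero ν (fun s y ↦ fderiv ℝ (Θ s) y v) t :=
  funext fun x ↦ fderiv_heatDuhamelZero_apply hΘ hν t x v

omit [MeasurableSpace E] [BorelSpace E] [FiniteDimensional ℝ F'] in
/-- The Laplacian of a difference of `C²` maps. [folklore] -/
theorem laplacian_sub_apply {f g : E → F'} (hf : ContDiff ℝ 2 f) (hg : ContDiff ℝ 2 g) (x : E) :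
    (Δ (fun y ↦ f y - g y)) x = (Δ f) x - (Δ g) x := by
  set b := stdOrthonormalBasis ℝ E
  rw [laplacian_eq_sum_fderiv_fderiv_normed b (hf.sub hg) x,
    laplacian_eq_sum_fderiv_fderiv_normed b hf x, laplacian_eq_sum_fderiv_fderiv_normed b hg x,
    ← Finset.sum_sub_distrib]
  refine Finset.sum_congr rfl fun i _ ↦ ?_
  have hdf : Differentiable ℝ f := hf.differentiable (by norm_num)
  have hdg : Differentiable ℝ g := hg.differentiable (by norm_num)
  have h1 : (fun y ↦ fderiv ℝ (fun z ↦ f z - g z) y (b i)) =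
      fun y ↦ fderiv ℝ f y (b i) - fderiv ℝ g y (b i) := by
    funext y
    rw [fderiv_fun_sub (hdf y) (hdg y)]
    rfl
  rw [h1]
  have hdf' : DifferentiableAt ℝ (fun y ↦ fderiv ℝ f y (b i)) x :=
    (((hf.fderiv_right (m := 1) le_rfl).clm_apply contDiff_const).differentiable (by norm_num)) x
  have hdg' : DifferentiableAt ℝ (fun y ↦ fderiv ℝ g y (b i)) x :=
    (((hg.fderiv_right (m := 1) le_rfl).clm_apply contDiff_const).differentiable (by norm_num)) x
  rw [fderiv_fun_sub hdf' hdg']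
  rfl

/-- **The Laplacian falls on the data**: `Δ v[Θ](t) = v[ΔΘ](t)`. [folklore] -/
theorem laplacian_heatDuhamelZero (hΘ : IsSpaceTimeTestOn (⊤ : Opens (ℝ × E)) Θ) (hν : 0 < ν)
    (t : ℝ) (x : E) :
    (Δ (heatDuhamelZero ν Θ t)) x = heatDuhamelZero ν (fun s ↦ Δ (Θ s)) t x := by
  haveI : CompleteSpace F' := FiniteDimensional.complete ℝ F'
  have hh := isHeatAdmissible_heatDuhamelFwd hν hΘ 0
  rw [show heatDuhamelZero ν Θ t = fun y ↦ heatDuhamelFwd ν Θ t y -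
      freeFlow ν (heatDuhamelFwd ν Θ 0) t y from rfl,
    laplacian_sub_apply ((contDiff_heatDuhamelFwd hΘ hν t).of_le (by norm_cast))
      ((hh.freeFlow hν t).contDiff.of_le (by norm_cast)),
    laplacian_heatDuhamelFwd hΘ hν t x, laplacian_freeFlow hh hν t x, heatDuhamelZero_apply]
  congr 2
  funext y
  exact laplacian_heatDuhamelFwd hΘ hν 0 y

/-- **The heat equation on `[0, ∞)`** (one-sided at `t = 0`):
`∂ₜv = νΔv + Θ` within `[0, ∞)` for every `t ≥ 0`. [cite: Evans2010, §2.3.1, Thm. 2] -/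
theorem hasDerivWithinAt_heatDuhamelZero (hΘ : IsSpaceTimeTestOn (⊤ : Opens (ℝ × E)) Θ)
    (hν : 0 < ν) {t : ℝ} (ht : 0 ≤ t) (x : E) :
    HasDerivWithinAt (fun s ↦ heatDuhamelZero ν Θ s x)
      (ν • (Δ (heatDuhamelZero ν Θ t)) x + Θ t x) (Ici 0) t := by
  haveI : CompleteSpace F' := FiniteDimensional.complete ℝ F'
  have hh := isHeatAdmissible_heatDuhamelFwd hν hΘ 0
  have h1 := (heatDuhamelFwd_heat hΘ hν t x).hasDerivWithinAt (s := Ici 0)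
  have h2 := hasDerivWithinAt_freeFlow hh hν ht x
  have h := h1.sub h2
  have hval : ν • (Δ (heatDuhamelFwd ν Θ t)) x + Θ t x - ν • freeFlow ν (Δ (heatDuhamelFwd ν Θ 0)) t x =
      ν • (Δ (heatDuhamelZero ν Θ t)) x + Θ t x := by
    rw [← laplacian_freeFlow hh hν t x,
      show heatDuhamelZero ν Θ t = fun y ↦ heatDuhamelFwd ν Θ t y -
        freeFlow ν (heatDuhamelFwd ν Θ 0) t y from rfl,
      laplacian_sub_apply ((contDiff_heatDuhamelFwd hΘ hν t).of_le (by norm_cast))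
        ((hh.freeFlow hν t).contDiff.of_le (by norm_cast)), smul_sub]
    abel
  rw [← hval]
  exact h

/-! ### The estimates of every order on `[0, T]` -/

section Estimates

/-- The energy of the initial value `h = 𝒱[Θ](0)` and of its gradient: for data with time
support in `[τ₀, b]`, `τ₀ ≤ 0 ≤ T`, `E_k(h) ≤ 4(T - τ₀) Q_k` and `Σᵢ E_k(∂ᵢh) ≤ (2n/ν) Q_k`,
`Q_k = ∫_{τ₀}^T E_k(Θ)`. [cite: LemarieRieusset2016, Prop. 4.3] -/
theorem sobolevEnergy_heatDuhamelFwd_zero_le (hΘ : IsSpaceTimeTestOn (⊤ : Opens (ℝ × E)) Θ)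
    (hν : 0 < ν) {τ₀ b : ℝ} (hab : ∀ s, s ∉ Icc τ₀ b → Θ s = 0) (hτ₀ : τ₀ ≤ 0) {T : ℝ}
    (hT : 0 ≤ T) (k : ℕ) :
    sobolevEnergy k (heatDuhamelFwd ν Θ 0) ≤
        ENNReal.ofReal (4 * (T - τ₀)) * ∫⁻ s in Ioo τ₀ T, sobolevEnergy k (Θ s) ∧
      ∑ i, sobolevEnergy k (fun x ↦ fderiv ℝ (heatDuhamelFwd ν Θ 0) x (stdOrthonormalBasis ℝ E i)) ≤
        ENNReal.ofReal (2 * (Module.finrank ℝ E : ℝ) / ν) * ∫⁻ s in Ioo τ₀ T, sobolevEnergy k (Θ s) :=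
  ⟨sobolevEnergy_heatDuhamelFwd_le hν k hΘ hab (hτ₀.trans hT) ⟨hτ₀, hT⟩,
    sum_sobolevEnergy_fderiv_heatDuhamelFwd_le hν k hΘ hab (hτ₀.trans hT) ⟨hτ₀, hT⟩⟩

/-- **Energy estimate at every order**: `E_k(v(t)) ≤ 16(T - τ₀) ∫_{τ₀}^T E_k(Θ)` for
`t ∈ [0, T]` (data with time support in `[τ₀, b]`, `τ₀ ≤ 0`). [cite: Evans2010, §2.3.1, Thm. 2] -/
theorem sobolevEnergy_heatDuhamelZero_le (hΘ : IsSpaceTimeTestOn (⊤ : Opens (ℝ × E)) Θ)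
    (hν : 0 < ν) {τ₀ b : ℝ} (hab : ∀ s, s ∉ Icc τ₀ b → Θ s = 0) (hτ₀ : τ₀ ≤ 0) {T : ℝ}
    (k : ℕ) {t : ℝ} (ht : t ∈ Icc 0 T) :
    sobolevEnergy k (heatDuhamelZero ν Θ t) ≤
      ENNReal.ofReal (16 * (T - τ₀)) * ∫⁻ s in Ioo τ₀ T, sobolevEnergy k (Θ s) := by
  haveI : CompleteSpace F' := FiniteDimensional.complete ℝ F'
  have hT : 0 ≤ T := ht.1.trans ht.2
  have hh := isHeatAdmissible_heatDuhamelFwd hν hΘ 0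
  set Q := ∫⁻ s in Ioo τ₀ T, sobolevEnergy k (Θ s)
  have hV : sobolevEnergy k (heatDuhamelFwd ν Θ t) ≤ ENNReal.ofReal (4 * (T - τ₀)) * Q :=
    sobolevEnergy_heatDuhamelFwd_le hν k hΘ hab (hτ₀.trans hT) ⟨hτ₀.trans ht.1, ht.2⟩
  have hW : sobolevEnergy k (freeFlow ν (heatDuhamelFwd ν Θ 0) t) ≤ ENNReal.ofReal (4 * (T - τ₀)) * Q :=
    (sobolevEnergy_freeFlow_le hν k hh t).trans (sobolevEnergy_heatDuhamelFwd_zero_le hΘ hν hab hτ₀ hT k).1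
  have hsub := sobolevEnergy_sub_le k ((contDiff_heatDuhamelFwd hΘ hν t).of_le (by exact_mod_cast le_top))
    ((hh.freeFlow hν t).contDiff.of_le (by exact_mod_cast le_top))
  calc sobolevEnergy k (heatDuhamelZero ν Θ t)
      ≤ 2 * sobolevEnergy k (heatDuhamelFwd ν Θ t) +
        2 * sobolevEnergy k (freeFlow ν (heatDuhamelFwd ν Θ 0) t) := hsub
    _ ≤ 2 * (ENNReal.ofReal (4 * (T - τ₀)) * Q) + 2 * (ENNReal.ofReal (4 * (T - τ₀)) * Q) :=
        add_le_add (mul_le_mul' le_rfl hV) (mul_le_mul' le_rfl hW)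
    _ = ENNReal.ofReal (16 * (T - τ₀)) * Q := by
        have h16 : ENNReal.ofReal (16 * (T - τ₀)) = 4 * ENNReal.ofReal (4 * (T - τ₀)) := by
          rw [show (16 : ℝ) * (T - τ₀) = 4 * (4 * (T - τ₀)) by ring,
            ENNReal.ofReal_mul (by norm_num : (0 : ℝ) ≤ 4)]
          simp
        rw [h16]
        ring

/-- Restricting a time integral of energies to a subinterval. [folklore] -/
theorem lintegral_Ioo_mono_left {f : ℝ → ENNReal} {a a' b : ℝ} (h : a ≤ a') :
    ∫⁻ s in Ioo a' b, f s ≤ ∫⁻ s in Ioo a b, f s :=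
  lintegral_mono_set (Ioo_subset_Ioo h le_rfl)

/-- **Gradient estimate at every order**: `∫_0^T Σᵢ E_k(∂ᵢv) ≤ (4(T-τ₀)/ν + 4nT/ν) ∫_{τ₀}^T E_k(Θ)`.
[cite: LemarieRieusset2016, Prop. 4.3 (B)] -/
theorem lintegral_sum_sobolevEnergy_fderiv_heatDuhamelZero_le
    (hΘ : IsSpaceTimeTestOn (⊤ : Opens (ℝ × E)) Θ) (hν : 0 < ν) {τ₀ b : ℝ}
    (hab : ∀ s, s ∉ Icc τ₀ b → Θ s = 0) (hτ₀ : τ₀ ≤ 0) {T : ℝ} (hT : 0 ≤ T) (k : ℕ) :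
    ∫⁻ t in Ioo 0 T, ∑ i, sobolevEnergy k
        (fun x ↦ fderiv ℝ (heatDuhamelZero ν Θ t) x (stdOrthonormalBasis ℝ E i)) ≤
      ENNReal.ofReal (4 * (T - τ₀) / ν + 4 * (Module.finrank ℝ E : ℝ) * T / ν) *
        ∫⁻ s in Ioo τ₀ T, sobolevEnergy k (Θ s) := by
  haveI : CompleteSpace F' := FiniteDimensional.complete ℝ F'
  have hh := isHeatAdmissible_heatDuhamelFwd hν hΘ 0
  set Q := ∫⁻ s in Ioo τ₀ T, sobolevEnergy k (Θ s)
  -- pointwise splitting of the integrand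
  have hpt : ∀ t, ∑ i, sobolevEnergy k
      (fun x ↦ fderiv ℝ (heatDuhamelZero ν Θ t) x (stdOrthonormalBasis ℝ E i)) ≤
      2 * ∑ i, sobolevEnergy k (fun x ↦ fderiv ℝ (heatDuhamelFwd ν Θ t) x (stdOrthonormalBasis ℝ E i)) +
        2 * ∑ i, sobolevEnergy k (fun x ↦ fderiv ℝ (freeFlow ν (heatDuhamelFwd ν Θ 0) t) x
          (stdOrthonormalBasis ℝ E i)) := fun t ↦ by
    rw [Finset.mul_sum, Finset.mul_sum, ← Finset.sum_add_distrib]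
    refine Finset.sum_le_sum fun i _ ↦ ?_
    have hd1 : Differentiable ℝ (heatDuhamelFwd ν Θ t) :=
      (contDiff_heatDuhamelFwd hΘ hν t).differentiable (by simp)
    have hd2 : Differentiable ℝ (freeFlow ν (heatDuhamelFwd ν Θ 0) t) :=
      (hh.freeFlow hν t).contDiff.differentiable (by simp)
    have heq : (fun x ↦ fderiv ℝ (heatDuhamelZero ν Θ t) x (stdOrthonormalBasis ℝ E i)) =
        fun x ↦ fderiv ℝ (heatDuhamelFwd ν Θ t) x (stdOrthonormalBasis ℝ E i) -
          fderiv ℝ (freeFlow ν (heatDuhamelFwd ν Θ 0) t) x (stdOrthonormalBasis ℝ E i) := by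
      funext x
      rw [show heatDuhamelZero ν Θ t = fun y ↦ heatDuhamelFwd ν Θ t y -
        freeFlow ν (heatDuhamelFwd ν Θ 0) t y from rfl, fderiv_fun_sub (hd1 x) (hd2 x)]
      rfl
    rw [heq]
    exact sobolevEnergy_sub_le k
      ((((contDiff_heatDuhamelFwd hΘ hν t).fderiv_right (m := ∞) (by norm_cast)).clm_apply
        contDiff_const).of_le (mod_cast le_top))
      ((((hh.freeFlow hν t).contDiff.fderiv_right (m := ∞) (by norm_cast)).clm_apply
        contDiff_const).of_le (mod_cast le_top))
  -- measurability of the `𝒱` part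
  have hVsm := isSmoothSpaceTimeOn_heatDuhamelFwd hν hΘ
  have hmeas : AEMeasurable (fun t ↦ 2 * ∑ i, sobolevEnergy k
      (fun x ↦ fderiv ℝ (heatDuhamelFwd ν Θ t) x (stdOrthonormalBasis ℝ E i)))
      (volume.restrict (Ioo 0 T)) := by
    refine AEMeasurable.const_mul (Finset.aemeasurable_fun_sum _ fun i _ ↦ ?_) _
    exact (measurable_sobolevEnergy_slice k (hVsm.isSmoothSpaceTimeOn_fderiv_apply isOpen_univ _)).aemeasurable
  calc ∫⁻ t in Ioo 0 T, ∑ i, sobolevEnergy k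
        (fun x ↦ fderiv ℝ (heatDuhamelZero ν Θ t) x (stdOrthonormalBasis ℝ E i))
      ≤ ∫⁻ t in Ioo 0 T, (2 * ∑ i, sobolevEnergy k
          (fun x ↦ fderiv ℝ (heatDuhamelFwd ν Θ t) x (stdOrthonormalBasis ℝ E i)) +
          2 * ∑ i, sobolevEnergy k (fun x ↦ fderiv ℝ (freeFlow ν (heatDuhamelFwd ν Θ 0) t) x
            (stdOrthonormalBasis ℝ E i))) := lintegral_mono fun t ↦ hpt t
    _ = 2 * (∫⁻ t in Ioo 0 T, ∑ i, sobolevEnergy k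
          (fun x ↦ fderiv ℝ (heatDuhamelFwd ν Θ t) x (stdOrthonormalBasis ℝ E i))) +
        2 * (∫⁻ t in Ioo 0 T, ∑ i, sobolevEnergy k (fun x ↦ fderiv ℝ
          (freeFlow ν (heatDuhamelFwd ν Θ 0) t) x (stdOrthonormalBasis ℝ E i))) := by
        rw [lintegral_add_left' hmeas, lintegral_const_mul' _ _ (by simp),
          lintegral_const_mul' _ _ (by simp)]
    _ ≤ 2 * (ENNReal.ofReal (2 * (T - τ₀) / ν) * Q) +
        2 * (ENNReal.ofReal T * (ENNReal.ofReal (2 * (Module.finrank ℝ E : ℝ) / ν) * Q)) := by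
        refine add_le_add (mul_le_mul' le_rfl ?_) (mul_le_mul' le_rfl ?_)
        · exact (lintegral_Ioo_mono_left hτ₀).trans
            (lintegral_sum_sobolevEnergy_fderiv_heatDuhamelFwd_le hν k hΘ hab (hτ₀.trans hT))
        · -- free part: pointwise `≤ Σᵢ E_k(∂ᵢ h) ≤ (2n/ν) Q`, integrated over `(0, T)`
          have hpt' : ∀ t, ∑ i, sobolevEnergy k (fun x ↦ fderiv ℝ
              (freeFlow ν (heatDuhamelFwd ν Θ 0) t) x (stdOrthonormalBasis ℝ E i)) ≤
              ENNReal.ofReal (2 * (Module.finrank ℝ E : ℝ) / ν) * Q := fun t ↦ by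
            refine le_trans (Finset.sum_le_sum fun i _ ↦ ?_)
              (sobolevEnergy_heatDuhamelFwd_zero_le hΘ hν hab hτ₀ hT k).2
            rw [show (fun x ↦ fderiv ℝ (freeFlow ν (heatDuhamelFwd ν Θ 0) t) x
                (stdOrthonormalBasis ℝ E i)) = freeFlow ν (fun y ↦ fderiv ℝ (heatDuhamelFwd ν Θ 0) y
                  (stdOrthonormalBasis ℝ E i)) t from funext fun x ↦ fderiv_freeFlow_apply hh hν t x _]
            exact sobolevEnergy_freeFlow_le hν k (hh.fderiv_apply _) t
          calc ∫⁻ t in Ioo 0 T, ∑ i, sobolevEnergy k (fun x ↦ fderiv ℝ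
                (freeFlow ν (heatDuhamelFwd ν Θ 0) t) x (stdOrthonormalBasis ℝ E i))
              ≤ ∫⁻ _ in Ioo 0 T, ENNReal.ofReal (2 * (Module.finrank ℝ E : ℝ) / ν) * Q := lintegral_mono fun t ↦ hpt' t
            _ = ENNReal.ofReal T * (ENNReal.ofReal (2 * (Module.finrank ℝ E : ℝ) / ν) * Q) := by
                rw [setLIntegral_const, Real.volume_Ioo, sub_zero]
                ring
    _ = ENNReal.ofReal (4 * (T - τ₀) / ν + 4 * (Module.finrank ℝ E : ℝ) * T / ν) * Q := by
        have h1 : (0 : ℝ) ≤ 2 * (T - τ₀) / ν := by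
          have : 0 ≤ T - τ₀ := by linarith
          positivity
        have h2 : (0 : ℝ) ≤ 2 * (Module.finrank ℝ E : ℝ) / ν := by positivity
        have hc : ENNReal.ofReal (4 * (T - τ₀) / ν + 4 * (Module.finrank ℝ E : ℝ) * T / ν) =
            2 * ENNReal.ofReal (2 * (T - τ₀) / ν) + 2 * (ENNReal.ofReal T * ENNReal.ofReal (2 * (Module.finrank ℝ E : ℝ) / ν)) := by
          rw [show (4 : ℝ) * (T - τ₀) / ν + 4 * (Module.finrank ℝ E : ℝ) * T / ν =
              2 * (2 * (T - τ₀) / ν) + 2 * (T * (2 * (Module.finrank ℝ E : ℝ) / ν)) by ring,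
            ENNReal.ofReal_add (by positivity) (by positivity),
            ENNReal.ofReal_mul (by norm_num : (0:ℝ) ≤ 2), ENNReal.ofReal_mul (by norm_num : (0:ℝ) ≤ 2),
            ENNReal.ofReal_mul hT]
          simp
        rw [hc]
        ring

/-- **Maximal regularity at every order, `T`-independent**:
`∫_0^T Σᵢⱼ E_k(∂ⱼ∂ᵢv) ≤ (6n/ν²) ∫_{τ₀}^T E_k(Θ)`. [cite: LemarieRieusset2016, Prop. 4.3 (C)] -/
theorem lintegral_sum_sobolevEnergy_fderiv_fderiv_heatDuhamelZero_le
    (hΘ : IsSpaceTimeTestOn (⊤ : Opens (ℝ × E)) Θ) (hν : 0 < ν) {τ₀ b : ℝ}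
    (hab : ∀ s, s ∉ Icc τ₀ b → Θ s = 0) (hτ₀ : τ₀ ≤ 0) {T : ℝ} (hT : 0 ≤ T) (k : ℕ) :
    ∫⁻ t in Ioo 0 T, ∑ i, ∑ j, sobolevEnergy k (fun x ↦
        fderiv ℝ (fun y ↦ fderiv ℝ (heatDuhamelZero ν Θ t) y (stdOrthonormalBasis ℝ E i)) x
          (stdOrthonormalBasis ℝ E j)) ≤
      ENNReal.ofReal (6 * (Module.finrank ℝ E : ℝ) / ν ^ 2) *
        ∫⁻ s in Ioo τ₀ T, sobolevEnergy k (Θ s) := by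
  haveI : CompleteSpace F' := FiniteDimensional.complete ℝ F'
  have hh := isHeatAdmissible_heatDuhamelFwd hν hΘ 0
  set Q := ∫⁻ s in Ioo τ₀ T, sobolevEnergy k (Θ s)
  set h₀ := heatDuhamelFwd ν Θ 0 with hh₀
  -- second derivatives of the two parts, function form
  have hVi : ∀ t i, (fun y ↦ fderiv ℝ (heatDuhamelFwd ν Θ t) y (stdOrthonormalBasis ℝ E i)) =
      heatDuhamelFwd ν (fun s z ↦ fderiv ℝ (Θ s) z (stdOrthonormalBasis ℝ E i)) t :=
    fun t i ↦ fderiv_heatDuhamelFwd_eq hΘ hν t _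
  have hWi : ∀ t i, (fun y ↦ fderiv ℝ (freeFlow ν h₀ t) y (stdOrthonormalBasis ℝ E i)) =
      freeFlow ν (fun z ↦ fderiv ℝ h₀ z (stdOrthonormalBasis ℝ E i)) t :=
    fun t i ↦ funext fun y ↦ fderiv_freeFlow_apply hh hν t y _
  -- pointwise splitting
  have hpt : ∀ t, ∑ i, ∑ j, sobolevEnergy k (fun x ↦
      fderiv ℝ (fun y ↦ fderiv ℝ (heatDuhamelZero ν Θ t) y (stdOrthonormalBasis ℝ E i)) x
        (stdOrthonormalBasis ℝ E j)) ≤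
      2 * ∑ i, ∑ j, sobolevEnergy k (fun x ↦ fderiv ℝ
          (fun y ↦ fderiv ℝ (heatDuhamelFwd ν Θ t) y (stdOrthonormalBasis ℝ E i)) x
            (stdOrthonormalBasis ℝ E j)) +
        2 * ∑ i, ∑ j, sobolevEnergy k (fun x ↦ fderiv ℝ
          (fun y ↦ fderiv ℝ (freeFlow ν h₀ t) y (stdOrthonormalBasis ℝ E i)) x
            (stdOrthonormalBasis ℝ E j)) := fun t ↦ by
    rw [Finset.mul_sum, Finset.mul_sum, ← Finset.sum_add_distrib]
    refine Finset.sum_le_sum fun i _ ↦ ?_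
    rw [Finset.mul_sum, Finset.mul_sum, ← Finset.sum_add_distrib]
    refine Finset.sum_le_sum fun j _ ↦ ?_
    -- `∂ⱼ∂ᵢ v = ∂ⱼ∂ᵢ V - ∂ⱼ∂ᵢ W` with smooth pieces
    have hΘi := hΘ.fderiv_apply_top (stdOrthonormalBasis ℝ E i)
    have h1 : (fun y ↦ fderiv ℝ (heatDuhamelZero ν Θ t) y (stdOrthonormalBasis ℝ E i)) =
        fun y ↦ heatDuhamelFwd ν (fun s z ↦ fderiv ℝ (Θ s) z (stdOrthonormalBasis ℝ E i)) t y -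
          freeFlow ν (fun z ↦ fderiv ℝ h₀ z (stdOrthonormalBasis ℝ E i)) t y := by
      rw [fderiv_heatDuhamelZero_eq hΘ hν t]
      funext y
      rw [heatDuhamelZero_apply]
      congr 2
      exact (fderiv_heatDuhamelFwd_eq hΘ hν 0 _).symm
    have hcV : ContDiff ℝ ∞ (heatDuhamelFwd ν (fun s z ↦ fderiv ℝ (Θ s) z (stdOrthonormalBasis ℝ E i)) t) :=
      contDiff_heatDuhamelFwd hΘi hν t
    have hcW : ContDiff ℝ ∞ (freeFlow ν (fun z ↦ fderiv ℝ h₀ z (stdOrthonormalBasis ℝ E i)) t) :=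
      ((hh.fderiv_apply _).freeFlow hν t).contDiff
    have h2 : (fun x ↦ fderiv ℝ (fun y ↦ fderiv ℝ (heatDuhamelZero ν Θ t) y
        (stdOrthonormalBasis ℝ E i)) x (stdOrthonormalBasis ℝ E j)) =
        fun x ↦ fderiv ℝ (fun y ↦ fderiv ℝ (heatDuhamelFwd ν Θ t) y (stdOrthonormalBasis ℝ E i)) x
            (stdOrthonormalBasis ℝ E j) -
          fderiv ℝ (fun y ↦ fderiv ℝ (freeFlow ν h₀ t) y (stdOrthonormalBasis ℝ E i)) x
            (stdOrthonormalBasis ℝ E j) := by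
      rw [h1, hVi t i, hWi t i]
      funext x
      rw [fderiv_fun_sub ((hcV.differentiable (by simp)) x) ((hcW.differentiable (by simp)) x)]
      rfl
    rw [h2]
    refine sobolevEnergy_sub_le k ?_ ?_
    · rw [hVi t i]
      exact ((hcV.fderiv_right (m := ∞) (by norm_cast)).clm_apply contDiff_const).of_le (mod_cast le_top)
    · rw [hWi t i]
      exact ((hcW.fderiv_right (m := ∞) (by norm_cast)).clm_apply contDiff_const).of_le (mod_cast le_top)
  -- measurability of the `𝒱` part
  have hVsm := isSmoothSpaceTimeOn_heatDuhamelFwd hν hΘ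
  have hmeas : AEMeasurable (fun t ↦ 2 * ∑ i, ∑ j, sobolevEnergy k (fun x ↦ fderiv ℝ
      (fun y ↦ fderiv ℝ (heatDuhamelFwd ν Θ t) y (stdOrthonormalBasis ℝ E i)) x
        (stdOrthonormalBasis ℝ E j))) (volume.restrict (Ioo 0 T)) := by
    refine AEMeasurable.const_mul (Finset.aemeasurable_fun_sum _ fun i _ ↦
      Finset.aemeasurable_fun_sum _ fun j _ ↦ ?_) _
    exact (measurable_sobolevEnergy_slice k ((hVsm.isSmoothSpaceTimeOn_fderiv_apply isOpen_univ
      _).isSmoothSpaceTimeOn_fderiv_apply isOpen_univ _)).aemeasurable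
  -- the free part: `Σᵢ (∫ Σⱼ E_k(∂ⱼ freeFlow (∂ᵢh))) ≤ Σᵢ ν⁻¹ E_k(∂ᵢ h) ≤ ν⁻¹ (2n/ν) Q`
  have hfree : ∫⁻ t in Ioo 0 T, ∑ i, ∑ j, sobolevEnergy k (fun x ↦ fderiv ℝ
      (fun y ↦ fderiv ℝ (freeFlow ν h₀ t) y (stdOrthonormalBasis ℝ E i)) x
        (stdOrthonormalBasis ℝ E j)) ≤
      ENNReal.ofReal ν⁻¹ * (ENNReal.ofReal (2 * (Module.finrank ℝ E : ℝ) / ν) * Q) := by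
    have hWsm := isSmoothSpaceTimeOn_freeFlow hh hν
    have hmono : (volume.restrict (Ioo 0 T) : Measure ℝ) ≤ volume.restrict (Ioi 0) :=
      Measure.restrict_mono (fun z (hz : z ∈ Ioo (0 : ℝ) T) ↦ (hz.1 : z ∈ Ioi (0 : ℝ))) le_rfl
    have hm : ∀ i, AEMeasurable (fun t ↦ ∑ j, sobolevEnergy k (fun x ↦ fderiv ℝ
        (fun y ↦ fderiv ℝ (freeFlow ν h₀ t) y (stdOrthonormalBasis ℝ E i)) x
          (stdOrthonormalBasis ℝ E j))) (volume.restrict (Ioo 0 T)) := fun i ↦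
      Finset.aemeasurable_fun_sum _ fun j _ ↦ (aemeasurable_sobolevEnergy_slice isOpen_Ioi k
        ((hWsm.isSmoothSpaceTimeOn_fderiv_apply isOpen_Ioi _).isSmoothSpaceTimeOn_fderiv_apply
          isOpen_Ioi _)).mono_measure hmono
    rw [lintegral_finsetSum' _ fun i _ ↦ hm i]
    calc ∑ i, ∫⁻ t in Ioo 0 T, ∑ j, sobolevEnergy k (fun x ↦ fderiv ℝ
          (fun y ↦ fderiv ℝ (freeFlow ν h₀ t) y (stdOrthonormalBasis ℝ E i)) x
            (stdOrthonormalBasis ℝ E j))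
        ≤ ∑ i, ENNReal.ofReal ν⁻¹ *
            sobolevEnergy k (fun z ↦ fderiv ℝ h₀ z (stdOrthonormalBasis ℝ E i)) := by
          refine Finset.sum_le_sum fun i _ ↦ ?_
          simp only [hWi]
          exact lintegral_sum_sobolevEnergy_fderiv_freeFlow_le hν k (hh.fderiv_apply _) T
      _ = ENNReal.ofReal ν⁻¹ * ∑ i, sobolevEnergy k
            (fun z ↦ fderiv ℝ h₀ z (stdOrthonormalBasis ℝ E i)) := by rw [Finset.mul_sum]
      _ ≤ ENNReal.ofReal ν⁻¹ * (ENNReal.ofReal (2 * (Module.finrank ℝ E : ℝ) / ν) * Q) := by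
          gcongr
          exact (sobolevEnergy_heatDuhamelFwd_zero_le hΘ hν hab hτ₀ hT k).2
  calc ∫⁻ t in Ioo 0 T, ∑ i, ∑ j, sobolevEnergy k (fun x ↦
          fderiv ℝ (fun y ↦ fderiv ℝ (heatDuhamelZero ν Θ t) y (stdOrthonormalBasis ℝ E i)) x
            (stdOrthonormalBasis ℝ E j))
      ≤ ∫⁻ t in Ioo 0 T, (2 * ∑ i, ∑ j, sobolevEnergy k (fun x ↦ fderiv ℝ
            (fun y ↦ fderiv ℝ (heatDuhamelFwd ν Θ t) y (stdOrthonormalBasis ℝ E i)) x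
              (stdOrthonormalBasis ℝ E j)) +
          2 * ∑ i, ∑ j, sobolevEnergy k (fun x ↦ fderiv ℝ
            (fun y ↦ fderiv ℝ (freeFlow ν h₀ t) y (stdOrthonormalBasis ℝ E i)) x
              (stdOrthonormalBasis ℝ E j))) := lintegral_mono fun t ↦ hpt t
    _ = 2 * (∫⁻ t in Ioo 0 T, ∑ i, ∑ j, sobolevEnergy k (fun x ↦ fderiv ℝ
            (fun y ↦ fderiv ℝ (heatDuhamelFwd ν Θ t) y (stdOrthonormalBasis ℝ E i)) x
              (stdOrthonormalBasis ℝ E j))) +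
        2 * (∫⁻ t in Ioo 0 T, ∑ i, ∑ j, sobolevEnergy k (fun x ↦ fderiv ℝ
            (fun y ↦ fderiv ℝ (freeFlow ν h₀ t) y (stdOrthonormalBasis ℝ E i)) x
              (stdOrthonormalBasis ℝ E j))) := by
        rw [lintegral_add_left' hmeas, lintegral_const_mul' _ _ (by simp),
          lintegral_const_mul' _ _ (by simp)]
    _ ≤ 2 * (ENNReal.ofReal ((Module.finrank ℝ E : ℝ) / ν ^ 2) * Q) + 2 * (ENNReal.ofReal ν⁻¹ * (ENNReal.ofReal (2 * (Module.finrank ℝ E : ℝ) / ν) * Q)) :=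
        add_le_add (mul_le_mul' le_rfl ((lintegral_Ioo_mono_left hτ₀).trans
          (lintegral_sum_sobolevEnergy_fderiv_fderiv_heatDuhamelFwd_le hν k hΘ hab (hτ₀.trans hT))))
          (mul_le_mul' le_rfl hfree)
    _ = ENNReal.ofReal (6 * (Module.finrank ℝ E : ℝ) / ν ^ 2) * Q := by
        have hν' : (0 : ℝ) ≤ ν⁻¹ := by positivity
        have hc : ENNReal.ofReal (6 * (Module.finrank ℝ E : ℝ) / ν ^ 2) =
            2 * ENNReal.ofReal ((Module.finrank ℝ E : ℝ) / ν ^ 2) + 2 * (ENNReal.ofReal ν⁻¹ * ENNReal.ofReal (2 * (Module.finrank ℝ E : ℝ) / ν)) := by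
          rw [← ENNReal.ofReal_mul hν',
            show ν⁻¹ * (2 * (Module.finrank ℝ E : ℝ) / ν) = 2 * ((Module.finrank ℝ E : ℝ) / ν ^ 2) by field_simp,
            show (6 : ℝ) * (Module.finrank ℝ E : ℝ) / ν ^ 2 = 2 * ((Module.finrank ℝ E : ℝ) / ν ^ 2) + 2 * (2 * ((Module.finrank ℝ E : ℝ) / ν ^ 2)) by ring,
            ENNReal.ofReal_add (by positivity) (by positivity),
            ENNReal.ofReal_mul (by norm_num : (0:ℝ) ≤ 2), ENNReal.ofReal_mul (by norm_num : (0:ℝ) ≤ 2)]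
          simp
        rw [hc]
        ring

end Estimates

end Literature.Analysis.PDE

end
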